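import Summits.NavierStokesRegularity.NavierStokesRegularity.Theorems.TypeILiouvilleTypeIliouvilleNoTypeIIEternalEnergyLiouvilleSteady
import HarnessLib

/-!
# Cesàro decay of local enstrophy under the `E`-bound, and the density of active times
# (crux `TypeIliouvilleNoTypeII`, stmt-NavierStokesRegularity-0056; rigidity residual EEL′ of the
# pressure-free eternal split)

Helper file (theorems only).  The pressure-free eternal energy Liouville statement EEL′ — the
`hEEL` binder of `EternalSplit.typeIliouvilleNoTypeII_of_pressureFreeSlab_of_eternalLiouville`: a
bounded eternal Oseen-mild smooth divergence-free `v`, `‖v‖ ≤ 2`, whose Albritton–Barker quantities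
`A`, `C`, `E` are bounded by a finite `I` on ALL parabolic balls, has `v(0,0) = 0` — is OPEN.  This
file turns the controlling-quantity reading of its `E`-clause (control-lens riders R1 / R2′ of the §B
Type-II cell, HOME `ns-plan-lens-control-typeII/EELRiders.lean`) into kernel theorems; the companion
file `…EternalEnergyLiouvillePeriodic.lean` uses them to settle EEL′ on the time-periodic stratum.

* `setLIntegral_window_ball_le_of_cknE_le` (R1) — the `E`-bound on ONE parabolic ball of radius `r`
  caps the dissipation of every thinner coaxial window: `∫∫_{(t-r²,t)×B_ρ(x)} |G|²_F ≤ r · I` for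
  `ρ ≤ r`;
* `tendsto_cesaro_window_ball_of_cknE_le` (R1, Cesàro form) — under `E ≤ I < ∞` on ALL balls
  the backward Cesàro means `L⁻¹ ∫∫_{(t-L,t)×B_ρ(x)} |G|²_F` tend to `0` as `L → ∞` (rate `I/√L`);
* `continuous_fderiv_slice`, `continuous_dissipationDensity` — the spatial gradient and the
  dissipation density `|∇v|²_F` of a jointly smooth field are jointly continuous;
* `volume_activeTimes_le_of_cknE_le` / `tendsto_density_activeTimes_of_cknE_le` (R2′) — Chebyshev:
  the set of ACTIVE times `{s ∈ (t-L,t) : ε ≤ ∫_{B_ρ(x)} |∇v(s)|²_F}` has density `≤ I/(ε√L) → 0`;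
  so an eternal field with RECURRENT local enstrophy (positive upper density of active times at
  `-∞` or, recentring, at `+∞`) violates the `E`-bound: the open core of EEL′ is the TRANSIENT
  stratum (density-zero enstrophy activity at both time ends, yet `‖v(0,0)‖ ≥ 1/2`).

WHAT THIS IS NOT: not NS; pure measure theory over the tree's `cknE`; EEL′ stays OPEN.
-/
noncomputable section

-- the summit and its single problem share the name `NavierStokesRegularity` (D-0017 nested layout)
set_option linter.dupNamespace false

open Set Function Filter Topology MeasureTheory Metric
open scoped NNReal ENNReal

namespace Summit.NavierStokesRegularity.NavierStokesRegularity.Theorems.TypeIliouvilleNoTypeII.TypeIIZoom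

open Literature.Analysis Literature.Analysis.FluidPDE
open Summit.NavierStokesRegularity.NavierStokesRegularity.Theorems.TypeIliouvilleNoTypeII.EternalSplit
  (le_mul_of_inv_mul_le)

variable {v : ℝ → EuclideanSpace ℝ (Fin 3) → EuclideanSpace ℝ (Fin 3)}

/-! ## R1 — the `E`-bound on a big ball caps the dissipation in every thinner coaxial window -/

/-- **R1.** If `E(G; Q_r(t, x)) ≤ I` and `ρ ≤ r`, `0 < r`, then
`∫∫_{(t - r², t) × B_ρ(x)} |G|²_F ≤ r · I`: the window `(t - r², t) × B_ρ(x)` sits inside the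
parabolic ball `Q_r(t, x)` and `E = r⁻¹ ∫∫_{Q_r} |G|²_F`.  With `L = r²` this is the Cesàro bound
`L⁻¹ ∫_{t-L}^{t} e_ρ(s) ds ≤ I / √L` for `e_ρ(s) = ∫_{B_ρ(x)} |G(s, ·)|²_F` (control-lens rider R1;
statement and proof by the §B planner seat ns-plan-lens-control-typeII). [folklore] -/
theorem setLIntegral_window_ball_le_of_cknE_le
    {G : ℝ → EuclideanSpace ℝ (Fin 3) → EuclideanSpace ℝ (Fin 3) →L[ℝ] EuclideanSpace ℝ (Fin 3)}
    {I : ℝ≥0∞} {ρ r t : ℝ} {x : EuclideanSpace ℝ (Fin 3)} (hr : 0 < r) (hρr : ρ ≤ r)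
    (hE : cknE r (t, x) G ≤ I) :
    ∫⁻ q in Ioo (t - r ^ 2) t ×ˢ ball x ρ, ENNReal.ofReal (frobeniusNormSq (G q.1 q.2)) ≤
      ENNReal.ofReal r * I := by
  have hsub : Ioo (t - r ^ 2) t ×ˢ ball x ρ ⊆ parabolicCylinder r (t, x) := by
    intro q hq
    simp only [parabolicCylinder, mem_prod, mem_Ioo, mem_ball] at hq ⊢
    exact ⟨hq.1, lt_of_lt_of_le hq.2 hρr⟩
  have hmono : ∫⁻ q in Ioo (t - r ^ 2) t ×ˢ ball x ρ, ENNReal.ofReal (frobeniusNormSq (G q.1 q.2)) ≤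
      ∫⁻ q in parabolicCylinder r (t, x), ENNReal.ofReal (frobeniusNormSq (G q.1 q.2)) :=
    lintegral_mono_set hsub
  have hr0 : ENNReal.ofReal r ≠ 0 := by simpa using hr
  refine hmono.trans (le_mul_of_inv_mul_le hr0 ENNReal.ofReal_ne_top ?_)
  simpa [cknE] using hE

/-- `√L → ∞` as `L → ∞`. [folklore] -/
theorem tendsto_sqrt_atTop' : Tendsto Real.sqrt atTop atTop := by
  refine tendsto_atTop_atTop.2 fun b => ⟨b ^ 2, fun L hL => ?_⟩
  calc b ≤ |b| := le_abs_self b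
    _ = Real.sqrt (b ^ 2) := (Real.sqrt_sq_eq_abs b).symm
    _ ≤ Real.sqrt L := Real.sqrt_le_sqrt hL

/-- `ρ ≤ √L` once `ρ² ≤ L`. [folklore] -/
theorem le_sqrt_of_sq_le' {ρ L : ℝ} (h : ρ ^ 2 ≤ L) : ρ ≤ Real.sqrt L :=
  calc ρ ≤ |ρ| := le_abs_self ρ
    _ = Real.sqrt (ρ ^ 2) := (Real.sqrt_sq_eq_abs ρ).symm
    _ ≤ Real.sqrt L := Real.sqrt_le_sqrt h

/-- The Cesàro normalisation: `(ofReal L)⁻¹ · ofReal √L = ofReal (√L)⁻¹` for `L > 0`. [folklore] -/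
theorem inv_ofReal_mul_ofReal_sqrt {L : ℝ} (hL : 0 < L) :
    (ENNReal.ofReal L)⁻¹ * ENNReal.ofReal (Real.sqrt L) = ENNReal.ofReal ((Real.sqrt L)⁻¹) := by
  have hsq : 0 < Real.sqrt L := Real.sqrt_pos.2 hL
  have hne0 : ENNReal.ofReal (Real.sqrt L) ≠ 0 := by simpa using hsq
  have hL' : ENNReal.ofReal L = ENNReal.ofReal (Real.sqrt L) * ENNReal.ofReal (Real.sqrt L) := by
    rw [← ENNReal.ofReal_mul hsq.le, Real.mul_self_sqrt hL.le]
  rw [hL', ENNReal.mul_inv (Or.inl hne0) (Or.inl ENNReal.ofReal_ne_top), mul_assoc,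
    ENNReal.inv_mul_cancel hne0 ENNReal.ofReal_ne_top, mul_one, ENNReal.ofReal_inv_of_pos hsq]

/-- The rate `I/√L → 0` in `ℝ≥0∞`, for `I ≠ ∞`. [folklore] -/
theorem tendsto_ofReal_inv_sqrt_mul {I : ℝ≥0∞} (hI : I ≠ ⊤) :
    Tendsto (fun L : ℝ => ENNReal.ofReal ((Real.sqrt L)⁻¹) * I) atTop (𝓝 0) := by
  have h1 : Tendsto (fun L : ℝ => (Real.sqrt L)⁻¹) atTop (𝓝 0) :=
    tendsto_inv_atTop_zero.comp tendsto_sqrt_atTop'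
  have h2 : Tendsto (fun L : ℝ => ENNReal.ofReal ((Real.sqrt L)⁻¹)) atTop (𝓝 0) := by
    have h := ENNReal.tendsto_ofReal h1
    rwa [ENNReal.ofReal_zero] at h
  have h3 := ENNReal.Tendsto.mul_const h2 (Or.inr hI)
  simpa using h3

/-- **R1, Cesàro form.**  Under `E(G; Q) ≤ I < ∞` on ALL parabolic balls, for every `ρ`, `x`, `t`,
the backward Cesàro means of the local enstrophy vanish:
`(ofReal L)⁻¹ ∫∫_{(t-L,t)×B_ρ(x)} |G|²_F → 0` as `L → ∞` (rate `I/√L`, from R1 with `r = √L`).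
Recentring at `(t₀ + L, x)` gives the forward means on `(t₀, t₀ + L)` too. [folklore] -/
theorem tendsto_cesaro_window_ball_of_cknE_le
    {G : ℝ → EuclideanSpace ℝ (Fin 3) → EuclideanSpace ℝ (Fin 3) →L[ℝ] EuclideanSpace ℝ (Fin 3)}
    {I : ℝ≥0∞} (hI : I ≠ ⊤)
    (hE : ∀ r : ℝ, 0 < r → ∀ z : ℝ × EuclideanSpace ℝ (Fin 3), cknE r z G ≤ I)
    (ρ : ℝ) (x : EuclideanSpace ℝ (Fin 3)) (t : ℝ) :
    Tendsto (fun L : ℝ => (ENNReal.ofReal L)⁻¹ *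
        ∫⁻ q in Ioo (t - L) t ×ˢ ball x ρ, ENNReal.ofReal (frobeniusNormSq (G q.1 q.2)))
      atTop (𝓝 0) := by
  have hup : ∀ᶠ L in atTop, (ENNReal.ofReal L)⁻¹ *
        ∫⁻ q in Ioo (t - L) t ×ˢ ball x ρ, ENNReal.ofReal (frobeniusNormSq (G q.1 q.2)) ≤
      ENNReal.ofReal ((Real.sqrt L)⁻¹) * I := by
    filter_upwards [eventually_ge_atTop (ρ ^ 2), eventually_gt_atTop 0] with L hLρ hL0
    have hsq : 0 < Real.sqrt L := Real.sqrt_pos.2 hL0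
    have h1 := setLIntegral_window_ball_le_of_cknE_le (t := t) (x := x) hsq (le_sqrt_of_sq_le' hLρ)
      (hE _ hsq _)
    rw [Real.sq_sqrt hL0.le] at h1
    calc (ENNReal.ofReal L)⁻¹ *
          ∫⁻ q in Ioo (t - L) t ×ˢ ball x ρ, ENNReal.ofReal (frobeniusNormSq (G q.1 q.2))
        ≤ (ENNReal.ofReal L)⁻¹ * (ENNReal.ofReal (Real.sqrt L) * I) := by gcongr
      _ = ENNReal.ofReal ((Real.sqrt L)⁻¹) * I := by
          rw [← mul_assoc, inv_ofReal_mul_ofReal_sqrt hL0]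
  exact tendsto_of_tendsto_of_tendsto_of_le_of_le' tendsto_const_nhds (tendsto_ofReal_inv_sqrt_mul hI)
    (Eventually.of_forall fun _ => zero_le) hup

/-! ## The dissipation density of a jointly smooth field -/

/-- The Frobenius norm squared is continuous along any continuous family of linear maps. [folklore] -/
theorem continuous_frobeniusNormSq_comp {X : Type*} [TopologicalSpace X]
    {F : X → EuclideanSpace ℝ (Fin 3) →L[ℝ] EuclideanSpace ℝ (Fin 3)} (hF : Continuous F) :
    Continuous fun q => frobeniusNormSq (F q) := by
  unfold frobeniusNormSq
  exact continuous_finsetSum _ fun i _ => ((hF.clm_apply continuous_const).norm).pow 2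

/-- The spatial gradient `(s, y) ↦ ∇v(s)(y)` of a jointly smooth field is jointly continuous.
[folklore] -/
theorem continuous_fderiv_slice (hv : ContDiff ℝ (⊤ : ℕ∞) (uncurry v)) :
    Continuous fun q : ℝ × EuclideanSpace ℝ (Fin 3) => fderiv ℝ (v q.1) q.2 := by
  have hφ : ContDiff ℝ (⊤ : ℕ∞)
      fun p : (ℝ × EuclideanSpace ℝ (Fin 3)) × EuclideanSpace ℝ (Fin 3) => (p.1.1, p.2) :=
    contDiff_fst.fst.prodMk contDiff_snd
  have hf : ContDiff ℝ (⊤ : ℕ∞)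
      (uncurry fun (q : ℝ × EuclideanSpace ℝ (Fin 3)) (y : EuclideanSpace ℝ (Fin 3)) => v q.1 y) :=
    hv.comp hφ
  have h0 : ContDiff ℝ 0 fun q : ℝ × EuclideanSpace ℝ (Fin 3) => fderiv ℝ (v q.1) q.2 :=
    hf.fderiv contDiff_snd (by rw [zero_add]; exact_mod_cast (le_top : (1 : ℕ∞) ≤ ⊤))
  exact h0.continuous

/-- The dissipation density `(s, y) ↦ |∇v(s)(y)|²_F` (valued in `ℝ≥0∞`) of a jointly smooth field
is continuous. [folklore] -/
theorem continuous_dissipationDensity (hv : ContDiff ℝ (⊤ : ℕ∞) (uncurry v)) :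
    Continuous fun q : ℝ × EuclideanSpace ℝ (Fin 3) =>
      ENNReal.ofReal (frobeniusNormSq (fderiv ℝ (v q.1) q.2)) :=
  ENNReal.continuous_ofReal.comp (continuous_frobeniusNormSq_comp (continuous_fderiv_slice hv))

/-- Tonelli on a window: `∫∫_{S × B} g = ∫_{s ∈ S} ∫_{y ∈ B} g(s, y)`. [folklore] -/
theorem setLIntegral_prod_eq_lintegral_lintegral {g : ℝ × EuclideanSpace ℝ (Fin 3) → ℝ≥0∞}
    (hg : Measurable g) (S : Set ℝ) (B : Set (EuclideanSpace ℝ (Fin 3))) :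
    ∫⁻ q in S ×ˢ B, g q = ∫⁻ s in S, ∫⁻ y in B, g (s, y) := by
  have hμ : (volume : Measure (ℝ × EuclideanSpace ℝ (Fin 3))).restrict (S ×ˢ B) =
      (volume.restrict S).prod (volume.restrict B) := by
    rw [Measure.volume_eq_prod, Measure.prod_restrict]
  rw [hμ, lintegral_prod _ hg.aemeasurable]

/-! ## R2′ — active times have density `≤ I/(ε √L)` -/

/-- **R2′ (Chebyshev on R1).**  Under `E(∇v; Q_{√L}(t, x)) ≤ I`, `ρ² ≤ L`, the ACTIVE times
`{s ∈ (t - L, t) : ε ≤ ∫_{B_ρ(x)} |∇v(s)|²_F}` satisfy `ε · |{active}| ≤ √L · I`. [folklore] -/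
theorem volume_activeTimes_le_of_cknE_le (hv : ContDiff ℝ (⊤ : ℕ∞) (uncurry v)) {I : ℝ≥0∞}
    (ε : ℝ≥0∞) {ρ L t : ℝ} {x : EuclideanSpace ℝ (Fin 3)} (hL : 0 < L) (hρL : ρ ^ 2 ≤ L)
    (hE : cknE (Real.sqrt L) (t, x) (fun s y => fderiv ℝ (v s) y) ≤ I) :
    ε * volume {s ∈ Ioo (t - L) t |
        ε ≤ ∫⁻ y in ball x ρ, ENNReal.ofReal (frobeniusNormSq (fderiv ℝ (v s) y))} ≤
      ENNReal.ofReal (Real.sqrt L) * I := by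
  have hgm : Measurable fun q : ℝ × EuclideanSpace ℝ (Fin 3) =>
      ENNReal.ofReal (frobeniusNormSq (fderiv ℝ (v q.1) q.2)) :=
    (continuous_dissipationDensity hv).measurable
  have hsq : 0 < Real.sqrt L := Real.sqrt_pos.2 hL
  have h1 := setLIntegral_window_ball_le_of_cknE_le (t := t) (x := x) hsq (le_sqrt_of_sq_le' hρL) hE
  rw [Real.sq_sqrt hL.le, setLIntegral_prod_eq_lintegral_lintegral hgm] at h1
  -- Markov on the time axis
  have hem : Measurable fun s : ℝ =>
      ∫⁻ y in ball x ρ, ENNReal.ofReal (frobeniusNormSq (fderiv ℝ (v s) y)) :=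
    hgm.lintegral_prod_right'
  have hM := mul_meas_ge_le_lintegral₀ (μ := volume.restrict (Ioo (t - L) t)) hem.aemeasurable ε
  rw [Measure.restrict_apply (measurableSet_le measurable_const hem)] at hM
  have hset : {s | ε ≤ ∫⁻ y in ball x ρ, ENNReal.ofReal (frobeniusNormSq (fderiv ℝ (v s) y))} ∩
      Ioo (t - L) t =
      {s ∈ Ioo (t - L) t |
        ε ≤ ∫⁻ y in ball x ρ, ENNReal.ofReal (frobeniusNormSq (fderiv ℝ (v s) y))} := by
    ext s
    simp only [mem_inter_iff, mem_setOf_eq]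
    tauto
  rw [hset] at hM
  exact hM.trans h1

/-- **R2′, density form.**  Under `E(∇v; Q) ≤ I < ∞` on ALL parabolic balls, for every ball
`B_ρ(x)`, every `t` and every `0 < ε < ∞`, the set of ACTIVE times `{s ∈ (t - L, t) : ε ≤ e_ρ(s)}`,
`e_ρ(s) = ∫_{B_ρ(x)} |∇v(s)|²_F`, has density `(ofReal L)⁻¹ |{active}| ≤ I/(ε √L) → 0` as
`L → ∞`.  Contrapositive: an eternal field whose local enstrophy is RECURRENT (positive upper
density of active times at `-∞`, or — recentring — at `+∞`) violates the `E`-bound; the open core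
of EEL′ is the TRANSIENT stratum. [folklore] -/
theorem tendsto_density_activeTimes_of_cknE_le (hv : ContDiff ℝ (⊤ : ℕ∞) (uncurry v)) {I : ℝ≥0∞}
    (hI : I ≠ ⊤)
    (hE : ∀ r : ℝ, 0 < r → ∀ z : ℝ × EuclideanSpace ℝ (Fin 3),
      cknE r z (fun s y => fderiv ℝ (v s) y) ≤ I)
    (ρ : ℝ) (x : EuclideanSpace ℝ (Fin 3)) (t : ℝ) {ε : ℝ≥0∞} (hε : ε ≠ 0) (hεtop : ε ≠ ⊤) :
    Tendsto (fun L : ℝ => (ENNReal.ofReal L)⁻¹ * volume {s ∈ Ioo (t - L) t |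
        ε ≤ ∫⁻ y in ball x ρ, ENNReal.ofReal (frobeniusNormSq (fderiv ℝ (v s) y))})
      atTop (𝓝 0) := by
  have hup : ∀ᶠ L in atTop, (ENNReal.ofReal L)⁻¹ * volume {s ∈ Ioo (t - L) t |
        ε ≤ ∫⁻ y in ball x ρ, ENNReal.ofReal (frobeniusNormSq (fderiv ℝ (v s) y))} ≤
      ε⁻¹ * (ENNReal.ofReal ((Real.sqrt L)⁻¹) * I) := by
    filter_upwards [eventually_ge_atTop (ρ ^ 2), eventually_gt_atTop 0] with L hLρ hL0
    have hsq : 0 < Real.sqrt L := Real.sqrt_pos.2 hL0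
    have h1 := volume_activeTimes_le_of_cknE_le hv ε hL0 hLρ (hE _ hsq (t, x))
    have h2 : volume {s ∈ Ioo (t - L) t |
        ε ≤ ∫⁻ y in ball x ρ, ENNReal.ofReal (frobeniusNormSq (fderiv ℝ (v s) y))} ≤
        ε⁻¹ * (ENNReal.ofReal (Real.sqrt L) * I) := by
      refine le_mul_of_inv_mul_le (ENNReal.inv_ne_zero.2 hεtop) (ENNReal.inv_ne_top.2 hε) ?_
      rwa [inv_inv]
    calc (ENNReal.ofReal L)⁻¹ * volume {s ∈ Ioo (t - L) t |
            ε ≤ ∫⁻ y in ball x ρ, ENNReal.ofReal (frobeniusNormSq (fderiv ℝ (v s) y))}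
        ≤ (ENNReal.ofReal L)⁻¹ * (ε⁻¹ * (ENNReal.ofReal (Real.sqrt L) * I)) := by gcongr
      _ = ε⁻¹ * ((ENNReal.ofReal L)⁻¹ * ENNReal.ofReal (Real.sqrt L) * I) := by ring
      _ = ε⁻¹ * (ENNReal.ofReal ((Real.sqrt L)⁻¹) * I) := by rw [inv_ofReal_mul_ofReal_sqrt hL0]
  have hlim : Tendsto (fun L : ℝ => ε⁻¹ * (ENNReal.ofReal ((Real.sqrt L)⁻¹) * I)) atTop (𝓝 0) := by
    have h := ENNReal.Tendsto.const_mul (tendsto_ofReal_inv_sqrt_mul hI)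
      (Or.inr (ENNReal.inv_ne_top.2 hε))
    simpa using h
  exact tendsto_of_tendsto_of_tendsto_of_le_of_le' tendsto_const_nhds hlim
    (Eventually.of_forall fun _ => zero_le) hup

end Summit.NavierStokesRegularity.NavierStokesRegularity.Theorems.TypeIliouvilleNoTypeII.TypeIIZoom

end
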